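import Mathlib.Topology.Instances.ZMod
import Literature.NumberTheory.EllipticCurves.SubgroupSelmer
import Literature.NumberTheory.GaloisRepresentations.IntegralGaloisAction
import HarnessLib

/-!
# The Mazur–Rubin twist `A_L` of an elliptic curve by a cyclic extension of prime degree

For a Weierstrass curve `W` (`E`) over a field `K`, a prime `p` and a cyclic extension `L/K` of
degree `p`, Mazur–Rubin (Ann. of Math. 166 (2007) = arXiv:math/0512085, whose numbering we use;
App. A = §9) attach to `E` the abelian variety `A_L := I_L ⊗ E` over `K` of dimension `p - 1`
(Def. 3.3; Mazur–Rubin–Silverberg Def. 1.1) — the kernel of the trace `Res^L_K E → E` — with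
`ℤ[Gal(L/K)] ↠ R_L = ℤ[ζ_p] ↪ End_K(A_L)` (Thm. 3.4(ii)) and the prime `𝔓 = (π)` of `R_L`
above `p`, `π` the image of `σ - 1` for a generator `σ` (proof of Prop. 5.2). This file builds
these objects in the tree's language of discrete Galois modules (`GaloisAction`, `Sha`, `Selmer`):

* `L/K ⊆ K̄/K` is presented by a continuous character `χ : Γ_K →ₜ* Multiplicative (ZMod p)`
  (`L = K̄^{ker χ}`, `Gal(L/K) ≅ ZMod p`, generator `σ ↔ 1`). `UnramifiedPrimeTwist K p` is the
  datum of a SURJECTIVE such `χ`, UNRAMIFIED AT EVERY PLACE (trivial on every inertia group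
  `I_𝔓 ⊆ Γ_K` and on the decomposition groups `Γ_{K_w} → Γ_K` of the infinite places): `L` is a
  degree-`p` subfield of the Hilbert class field of `K` (so `p ∣ h_K`).
* `PrimeTwist.ResPoints χ M` (any `Γ`-module `M`; here `M = E(K̄)`): the points `E(X ⊗_K L) =
  ∏_{τ : L → X} E(X)` of the restriction of scalars (MR Prop. 3.1(i)) as functions
  `Gal(L/K) = ZMod p → M` with the diagonal action `(γ • f) i = γ • f (i - χ γ)`; the trace
  `PrimeTwist.trace` and **the twist `PrimeTwist.points χ M = ker (trace)`** — MR Thm. 3.4(iii):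
  `A_L(X) = {x ∈ E(X ⊗_K L) : ∑_{h ∈ Gal(L/K)} (1 ⊗ h) x = 0}`.
* The `R_L`-action through its generator: `PrimeTwist.shift` (`σ`, acting through `L`:
  `(σ f) i = f (i + 1)`), `PrimeTwist.piEnd = σ - 1` (`π`), both `Γ`-equivariant, and the norm
  relation `∑_{j<p} σ^j = 0` (`sum_shift_iterate`), so `ℤ[G]` acts through `R_L = ℤ[σ]/(∑ σ^j)`.
  As `R_L/𝔓 = 𝔽_p` and `𝔓^{p-1} = (p)`: `𝔓^∞`-torsion = `p^∞`-torsion, `A[𝔓] = ker π`, and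
  `length_{R_L} N = log_p #N` for a finite `𝔓`-primary `R_L`-module `N`.
* **MR Prop. 4.1 / Remark 4.2, PROVED**: `E[p] = A_L[𝔓]` as `Γ_K`-modules — the constant maps
  `PrimeTwist.constEmb : M[p] → points χ M` are equivariant, injective, with range `ker π`
  (`range_constEmb`).
* For `W/K` and a `K`-field `E` (a completion): `PrimeTwist.geomModule W χ = A_χ(K̄)`,
  `PrimeTwist.localModule W χ E = A_χ(K̄_E)` (character `χ ∘ (Γ_E → Γ_K)`), the localisation
  `locMap` along the chosen `K̄ → K̄_E` (`pointsMap`, file `Sha`); `H¹(K, A_χ)`, `H¹(K, A_χ[p^∞])`.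
* Selmer groups over a number field, built EXACTLY like `WeierstrassCurve.selmerGroup`/`sha`:
  the `𝔓`-Selmer local condition `selmerLocalKer W χ E = ker (H¹(K, E[p]) → H¹(E, A_χ))` along
  `E[p] = A_χ[𝔓] ⊆ A_χ(K̄) → A_χ(K̄_E)` — MR Def. 4.3, the Selmer structure `𝒜` on `E[p]` got
  through Prop. 4.1 — and **`Sel_𝔓(A_χ/K) = PrimeTwist.selmerGroup W χ ⊆ H¹(K, E[p])`**, in the
  SAME group `W.galH1Torsion p` as `Sel_p(E/K) = W.selmerGroup p`; `Sel_{𝔓^∞}(A_χ/K) =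
  selmerGroupPInfty`, `Ш(A_χ/K) = sha` (MR §2); the comparison "`Sel_𝔓(A_χ/K) = Sel_p(E/K)`
  when the local conditions agree everywhere" is `selmerGroup_eq_selmerGroup` (formal).

## Not here (documented gaps)

* The local comparisons (MR Cor. 4.6, Prop. 5.2, Lemma 5.5, Thms. 5.6–6.7: the `δ_v`), the
  self-duality of `𝒜` (Prop. 4.4 = 9.7) and the perfect `Gal(K/k)`-equivariant skew-Hermitian
  Cassels–Tate–Flach pairing on `Ш(A_L/K)[p^∞]/div` (Thm. 6.1, Thm. 9.12, Flach 1990): the last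
  needs the `R_L`-structure on `Ш` and the model of `A_L` over `k` (Prop. 9.9, depending on a
  lift of `c`) — separate requests. Existence of unramified twists from `p ∣ h_K` is class
  field theory, not stated here.
* As for `WeierstrassCurve.selmerGroup`, identifying `selmerLocalKer` with the Kummer image
  `A(K_v)/𝔓A(K_v) ↪ H¹(K_v, A[𝔓])` rests on the exactness of `0 → A[𝔓] → A(K̄_v) →π A(K̄_v) → 0`
  (`π` onto as `E(K̄_v)` is divisible); only the cohomological form is used.
* Prime degree only; TODO(general form): `[L : K] = p^n`, `A_L(X) = ker ∑_{h ∈ Gal(L/M)} h`.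

## Design

`ResPoints` is a one-field structure (on the bare function type the pointwise `Γ`-action would
clash with the diagonal one) with `FunLike`, transported `AddCommGroup` and the discrete
topology; `points`, torsion and `p`-primary parts are `AddSubgroup`s coerced to types with the
restricted actions (`points.instDistribMulAction`, the tree's `torsionBy`/`primaryComponent`
instances). One universe `u` for `K`, `E` (forced by `ContinuousCohomology.map`).

## References

* B. Mazur, K. Rubin, *Finding large Selmer rank via an arithmetic theory of local constants*,
  Ann. of Math. 166 (2007), 579–612; arXiv:math/0512085. [MazurRubin2007]
* B. Mazur, K. Rubin, A. Silverberg, *Twisting commutative algebraic groups*, J. Algebra 314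
  (2007), 419–438. [MazurRubinSilverberg2007]
-/

noncomputable section

open scoped Classical
open scoped AddSubgroup

universe u

namespace Literature.NumberTheory.EllipticCurves

namespace PrimeTwist

/-! ## Restriction of scalars and twist of a `Γ`-module along `χ : Γ → ZMod p` -/

variable {Γ : Type*} [Group Γ] {p : ℕ}

/-- The points `E(X ⊗_K L) = ∏_{τ : L → X} E(X)` of the restriction of scalars of the
`Γ`-module `M` along the cyclic extension cut out by `χ`: functions `Gal(L/K) = ZMod p → M`, with
the diagonal `Γ`-action `ResPoints.instDistribMulAction`. [cite: MazurRubin2007, Prop 3.1(i)] -/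
structure ResPoints (χ : Γ →* Multiplicative (ZMod p)) (M : Type*) where
  /-- the underlying function on `Gal(L/K) = ZMod p` -/
  toFun : ZMod p → M

section Basic

variable (χ : Γ →* Multiplicative (ZMod p)) (M : Type*)

namespace ResPoints

/-- Elements of `ResPoints χ M` are functions `ZMod p → M`. [folklore] -/
instance instFunLike : FunLike (ResPoints χ M) (ZMod p) M where
  coe := toFun
  coe_injective f g h := by cases f; cases g; congr

/-- Extensionality for `ResPoints`. [folklore] -/
@[ext]
theorem ext {f g : ResPoints χ M} (h : ∀ i, f i = g i) : f = g := DFunLike.ext f g h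

/-- Evaluation of `ResPoints.mk`. [folklore] -/
@[simp] theorem mk_apply (f : ZMod p → M) (i : ZMod p) : (mk f : ResPoints χ M) i = f i := rfl

variable [AddCommGroup M]

/-- Pointwise group structure (`E(X ⊗_K L) = ∏ E(X)` as a group). [folklore] -/
instance instAddCommGroup : AddCommGroup (ResPoints χ M) :=
  (⟨toFun, mk, fun _ ↦ rfl, fun _ ↦ rfl⟩ : ResPoints χ M ≃ (ZMod p → M)).addCommGroup

/-- The discrete topology. [folklore] -/
instance instTopologicalSpace : TopologicalSpace (ResPoints χ M) := ⊥

/-- The topology is discrete by definition. [folklore] -/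
instance instDiscreteTopology : DiscreteTopology (ResPoints χ M) := ⟨rfl⟩

/-- Pointwise zero. [folklore] -/
@[simp] theorem zero_apply (i : ZMod p) : (0 : ResPoints χ M) i = 0 := rfl

/-- Pointwise addition. [folklore] -/
@[simp] theorem add_apply (f g : ResPoints χ M) (i : ZMod p) : (f + g) i = f i + g i := rfl

/-- Pointwise subtraction. [folklore] -/
@[simp] theorem sub_apply (f g : ResPoints χ M) (i : ZMod p) : (f - g) i = f i - g i := rfl

/-- Evaluation at `i : ZMod p` as a group homomorphism. [folklore] -/
def evalHom (i : ZMod p) : ResPoints χ M →+ M where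
  toFun f := f i
  map_zero' := rfl
  map_add' _ _ := rfl

/-- Finite sums are computed pointwise. [folklore] -/
theorem sum_apply {ι : Type*} (s : Finset ι) (g : ι → ResPoints χ M) (i : ZMod p) :
    (∑ j ∈ s, g j) i = ∑ j ∈ s, g j i :=
  map_sum (evalHom χ M i) g s

/-- The image `χ γ ∈ Gal(L/K) = ZMod p` of `γ`, read additively. [folklore] -/
abbrev expo (γ : Γ) : ZMod p := Multiplicative.toAdd (χ γ)

variable [DistribMulAction Γ M]

/-- The diagonal action of `Γ` on `E(X ⊗_K L) = ∏_{τ} E(X)` (`γ ⊗ 1`, `τ ↦ γ ∘ τ`):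
`(γ • f) i = γ • f (i - χ γ)` (MR Prop. 3.1, proof of (iii): `γ⁻¹ ⊗ γ` on `ℤ[G] ⊗ E`).
[cite: MazurRubin2007, Prop 3.1] -/
instance instDistribMulAction : DistribMulAction Γ (ResPoints χ M) where
  smul γ f := ⟨fun i ↦ γ • f (i - expo χ γ)⟩
  one_smul f := by
    ext i
    change (1 : Γ) • f (i - expo χ 1) = _
    simp [expo]
  mul_smul γ δ f := by
    ext i
    change (γ * δ) • f (i - expo χ (γ * δ)) = γ • δ • f (i - expo χ γ - expo χ δ)
    rw [mul_smul, expo, map_mul, toAdd_mul]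
    congr 2
    abel
  smul_zero γ := by
    ext i
    exact smul_zero γ
  smul_add γ f g := by
    ext i
    exact smul_add γ _ _

/-- Unfolding the action: `(γ • f) i = γ • f (i - χ γ)`. [cite: MazurRubin2007, Prop 3.1] -/
@[simp]
theorem smul_apply' (γ : Γ) (f : ResPoints χ M) (i : ZMod p) :
    (γ • f) i = γ • f (i - expo χ γ) :=
  rfl

end ResPoints

variable [AddCommGroup M] [Fact p.Prime]

/-- The trace `E(X ⊗_K L) → E(X)`, `f ↦ ∑ i, f i` (`∑_{h ∈ Gal(L/K)} (1 ⊗ h)`, MR Thm. 3.4(iii)).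
[cite: MazurRubin2007, Thm 3.4(iii)] -/
def trace : ResPoints χ M →+ M where
  toFun f := ∑ i, f i
  map_zero' := Finset.sum_eq_zero fun _ _ ↦ rfl
  map_add' _ _ := Finset.sum_add_distrib

/-- Unfolding `trace`. [cite: MazurRubin2007, Thm 3.4(iii)] -/
theorem trace_apply (f : ResPoints χ M) : trace χ M f = ∑ i, f i := rfl

/-- **The Mazur–Rubin twist** of `M` by the degree-`p` cyclic extension cut out by `χ`: the
kernel of the trace, `A_L(X) = {x ∈ E(X ⊗_K L) : ∑_{h ∈ Gal(L/K)} (1 ⊗ h) x = 0}` (MR Thm.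
3.4(iii) with `[L : K] = p`), the `X`-points of `A_L = I_L ⊗ E` (Def. 3.3).
[cite: MazurRubin2007, Def 3.3 and Thm 3.4(iii)] -/
def points : AddSubgroup (ResPoints χ M) := (trace χ M).ker

/-- Membership in the twist: `∑ i, f i = 0`. [cite: MazurRubin2007, Thm 3.4(iii)] -/
theorem mem_points_iff (f : ResPoints χ M) : f ∈ points χ M ↔ ∑ i, f i = 0 := Iff.rfl

/-- The generator `σ ↔ 1 ∈ ZMod p` of `Gal(L/K)` acting on `E(X ⊗_K L)` through `L`
(MR Prop. 3.1(ii): `ℤ[G] ↪ End_K(Res E)`): `(σ f) i = f (i + 1)`.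
[cite: MazurRubin2007, Prop 3.1(ii)] -/
def shiftRes : ResPoints χ M →+ ResPoints χ M where
  toFun f := ⟨fun i ↦ f (i + 1)⟩
  map_zero' := rfl
  map_add' _ _ := rfl

/-- Unfolding `shiftRes`. [cite: MazurRubin2007, Prop 3.1(ii)] -/
@[simp]
theorem shiftRes_apply (f : ResPoints χ M) (i : ZMod p) : shiftRes χ M f i = f (i + 1) := rfl

/-- The trace is `σ`-invariant. [folklore] -/
theorem trace_shiftRes (f : ResPoints χ M) : trace χ M (shiftRes χ M f) = trace χ M f := by
  simp only [trace_apply, shiftRes_apply]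
  exact Fintype.sum_equiv (Equiv.addRight 1) _ _ fun _ ↦ rfl

/-- The generator `σ` of `Gal(L/K)` acting on the twist `A_L` (MR Thm. 3.4(ii):
`ℤ[G] ↠ R_L ↪ End_K(A_L)`, `σ ↦ ζ_p`). [cite: MazurRubin2007, Thm 3.4(ii)] -/
def shift : points χ M →+ points χ M :=
  ((shiftRes χ M).comp (points χ M).subtype).codRestrict (points χ M) fun f ↦ by
    change shiftRes χ M f ∈ (trace χ M).ker
    rw [AddMonoidHom.mem_ker, trace_shiftRes]
    exact f.2

/-- Unfolding `shift`. [cite: MazurRubin2007, Thm 3.4(ii)] -/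
@[simp]
theorem coe_shift (f : points χ M) :
    ((shift χ M f : points χ M) : ResPoints χ M) = shiftRes χ M f :=
  rfl

/-- The endomorphism `π = σ - 1` of the twist; its image in `R_L = ℤ[ζ_p]` generates the prime
`𝔓` above `p` (MR, proof of Prop. 5.2), so `A_L[𝔓] = ker π`.
[cite: MazurRubin2007, proof of Prop 5.2] -/
def piEnd : points χ M →+ points χ M := shift χ M - AddMonoidHom.id _

/-- Unfolding `piEnd`: `π f = σ f - f`. [cite: MazurRubin2007, proof of Prop 5.2] -/
theorem piEnd_apply (f : points χ M) : piEnd χ M f = shift χ M f - f := rfl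

/-- Iterates of `σ`: `(σ^n f) i = f (i + n)`. [folklore] -/
theorem coe_shift_iterate (f : points χ M) (n : ℕ) (i : ZMod p) :
    ((shift χ M)^[n] f : ResPoints χ M) i = (f : ResPoints χ M) (i + n) := by
  induction n generalizing i with
  | zero => simp
  | succ n ih =>
    rw [Function.iterate_succ_apply', coe_shift, shiftRes_apply, ih, Nat.cast_succ]
    congr 1
    abel

/-- **The norm relation** `∑_{j < p} σ^j = 0` on the twist: `ℤ[Gal(L/K)]` acts on `A_L` through
`R_L = ℤ[G]/(∑_g g) ≅ ℤ[ζ_p]` (MR Thm. 3.4(ii)). [cite: MazurRubin2007, Thm 3.4(ii)] -/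
theorem sum_shift_iterate (f : points χ M) : ∑ j : ZMod p, (shift χ M)^[j.val] f = 0 := by
  apply Subtype.ext
  rw [AddSubmonoidClass.coe_finsetSum]
  ext i
  rw [ResPoints.sum_apply]
  simp only [coe_shift_iterate, ZMod.natCast_zmod_val, ZeroMemClass.coe_zero,
    ResPoints.zero_apply]
  rw [← (mem_points_iff χ M _).mp f.2]
  exact Fintype.sum_equiv (Equiv.addLeft i) _ _ fun _ ↦ rfl

/-- The constant maps `M[p] → A_L`, `P ↦ (i ↦ P)` (`∑ i, P = p • P = 0`): the inclusion
`E ⊆ Res^L_K E` (`E(X ⊗_K K) ⊆ E(X ⊗_K L)`) restricted to `E[p] = E ∩ A_L` (MR Remark 4.2).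
[cite: MazurRubin2007, Remark 4.2] -/
def constEmb : M[(p : ℤ)] →+ points χ M where
  toFun P := ⟨⟨fun _ ↦ (P : M)⟩, by
    rw [mem_points_iff]
    simp only [ResPoints.mk_apply, Finset.sum_const, Finset.card_univ, ZMod.card]
    exact AddSubgroup.torsionBy.nsmul_iff.mp P.2⟩
  map_zero' := rfl
  map_add' _ _ := rfl

/-- Unfolding `constEmb`. [cite: MazurRubin2007, Remark 4.2] -/
@[simp]
theorem constEmb_apply (P : M[(p : ℤ)]) (i : ZMod p) : (constEmb χ M P : ResPoints χ M) i = P :=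
  rfl

/-- `constEmb` is injective. [cite: MazurRubin2007, Remark 4.2] -/
theorem constEmb_injective : Function.Injective (constEmb χ M) := fun _ _ h ↦
  Subtype.ext (congrArg (fun f : points χ M ↦ (f : ResPoints χ M) 0) h)

/-- **`A_L[𝔓] = E[p]`** (MR Prop. 4.1, in the form of Remark 4.2: `E[p] = E ∩ A_L = A_L[𝔓]` in
`Res^L_K E`): the range of the constant embedding `M[p] → A_L` is the kernel of `π = σ - 1`.
Proof: a `σ`-invariant function on `ZMod p` is constant, and a constant `c` lies in the twist
iff `p • c = 0`. With `constEmb_smul`, `constEmb_injective` this is the canonical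
`Γ_K`-isomorphism `E[p] ≅ A_L[𝔓]`. [cite: MazurRubin2007, Prop 4.1 and Remark 4.2] -/
theorem range_constEmb : (constEmb χ M).range = (piEnd χ M).ker := by
  ext f
  constructor
  · rintro ⟨P, rfl⟩
    rw [AddMonoidHom.mem_ker]
    exact Subtype.ext (ResPoints.ext χ M fun i ↦ sub_self _)
  · intro hf
    rw [AddMonoidHom.mem_ker, piEnd_apply, sub_eq_zero] at hf
    have hper : ∀ i : ZMod p, (f : ResPoints χ M) (i + 1) = (f : ResPoints χ M) i := fun i ↦
      congrArg (fun g : points χ M ↦ (g : ResPoints χ M) i) hf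
    have hconst : ∀ i : ZMod p, (f : ResPoints χ M) i = (f : ResPoints χ M) 0 := by
      intro i
      rw [← ZMod.natCast_zmod_val i]
      induction i.val with
      | zero => rw [Nat.cast_zero]
      | succ n ih => rw [Nat.cast_succ, hper, ih]
    have hsum : p • (f : ResPoints χ M) 0 = 0 := by
      have h := (mem_points_iff χ M _).mp f.2
      simp_rw [hconst] at h
      rwa [Finset.sum_const, Finset.card_univ, ZMod.card] at h
    exact ⟨⟨(f : ResPoints χ M) 0, AddSubgroup.torsionBy.nsmul_iff.mpr hsum⟩,
      Subtype.ext (ResPoints.ext χ M fun i ↦ (hconst i).symm)⟩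

variable {Γ' : Type*} [Group Γ'] {M' : Type*} [AddCommGroup M'] (φ : Γ' →* Γ) (ψ : M →+ M')

/-- Functoriality of the twist: `ψ : M → M'` induces `points χ M → points (χ ∘ φ) M'`,
`f ↦ ψ ∘ f` (the localisation `A_L(K̄) → A_L(K̄_v)` along `Γ_{K_v} → Γ_K`; MR §5, the local
extensions `(L ⊗_K K_v)/K_v`). [folklore] -/
def pushforward : points χ M →+ points (χ.comp φ) M' where
  toFun f := ⟨⟨fun i ↦ ψ ((f : ResPoints χ M) i)⟩, by
    rw [mem_points_iff]
    simp only [ResPoints.mk_apply]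
    rw [← map_sum, (mem_points_iff χ M _).mp f.2, map_zero]⟩
  map_zero' := Subtype.ext (ResPoints.ext _ _ fun i ↦ by simp)
  map_add' f g := Subtype.ext (ResPoints.ext _ _ fun i ↦ by simp)

/-- Unfolding `pushforward`. [folklore] -/
@[simp]
theorem pushforward_apply (f : points χ M) (i : ZMod p) :
    (pushforward χ M φ ψ f : ResPoints (χ.comp φ) M') i = ψ ((f : ResPoints χ M) i) :=
  rfl

section Action

variable [DistribMulAction Γ M]

/-- The trace is `Γ`-equivariant. [cite: MazurRubin2007, Prop 3.1] -/
theorem trace_smul (γ : Γ) (f : ResPoints χ M) : trace χ M (γ • f) = γ • trace χ M f := by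
  simp only [trace_apply, ResPoints.smul_apply', Finset.smul_sum]
  exact Fintype.sum_equiv (Equiv.subRight (ResPoints.expo χ γ)) _ _ fun _ ↦ rfl

/-- The twist is `Γ`-stable (`A_L` is defined over `K`, MR Def. 3.3).
[cite: MazurRubin2007, Def 3.3] -/
theorem smul_mem_points (γ : Γ) {f : ResPoints χ M} (hf : f ∈ points χ M) :
    γ • f ∈ points χ M := by
  change _ ∈ (trace χ M).ker at hf ⊢
  rw [AddMonoidHom.mem_ker] at hf ⊢
  rw [trace_smul, hf, smul_zero]

/-- The `Γ`-module `A_L(K̄)` (restriction of the diagonal action).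
[cite: MazurRubin2007, Def 3.3 and Thm 3.4(iii)] -/
instance points.instDistribMulAction : DistribMulAction Γ (points χ M) where
  smul γ f := ⟨γ • (f : ResPoints χ M), smul_mem_points χ M γ f.2⟩
  one_smul f := Subtype.ext (one_smul Γ (f : ResPoints χ M))
  mul_smul γ δ f := Subtype.ext (mul_smul γ δ (f : ResPoints χ M))
  smul_zero γ := Subtype.ext (smul_zero γ)
  smul_add γ f g := Subtype.ext (smul_add γ (f : ResPoints χ M) g)

/-- Unfolding the restricted action. [folklore] -/
@[simp]
theorem points.coe_smul (γ : Γ) (f : points χ M) :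
    ((γ • f : points χ M) : ResPoints χ M) = γ • (f : ResPoints χ M) :=
  rfl

/-- `σ` commutes with `Γ` (`Gal(L/K)` is abelian; MR Thm. 3.4(ii): `R_L ↪ End_K(A_L)`).
[cite: MazurRubin2007, Thm 3.4(ii)] -/
theorem shiftRes_smul (γ : Γ) (f : ResPoints χ M) : shiftRes χ M (γ • f) = γ • shiftRes χ M f := by
  ext i
  simp only [shiftRes_apply, ResPoints.smul_apply']
  congr 2
  abel

/-- `σ` is `Γ`-equivariant on the twist. [cite: MazurRubin2007, Thm 3.4(ii)] -/
theorem shift_smul (γ : Γ) (f : points χ M) : shift χ M (γ • f) = γ • shift χ M f :=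
  Subtype.ext (shiftRes_smul χ M γ f)

/-- `π = σ - 1` is `Γ`-equivariant on the twist. [cite: MazurRubin2007, Thm 3.4(ii)] -/
theorem piEnd_smul (γ : Γ) (f : points χ M) : piEnd χ M (γ • f) = γ • piEnd χ M f := by
  rw [piEnd_apply, piEnd_apply, shift_smul, smul_sub]

/-- The constant embedding `E[p] → A_L` is `Γ`-equivariant (`E[p] ≅ A_L[𝔓]` as `Γ_K`-modules,
MR Prop. 4.1). [cite: MazurRubin2007, Prop 4.1] -/
theorem constEmb_smul (γ : Γ) (P : M[(p : ℤ)]) : constEmb χ M (γ • P) = γ • constEmb χ M P :=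
  rfl

/-- `pushforward` along a compatible pair `(φ, ψ)` (`ψ (φ x • m) = x • ψ m`) is equivariant.
[folklore] -/
theorem pushforward_smul [DistribMulAction Γ' M'] (h : ∀ (x : Γ') (m : M), ψ (φ x • m) = x • ψ m)
    (x : Γ') (f : points χ M) : pushforward χ M φ ψ (φ x • f) = x • pushforward χ M φ ψ f :=
  Subtype.ext (ResPoints.ext _ _ fun i ↦ by simp [h]; rfl)

end Action

end Basic

/-! ## The twist of a Weierstrass curve: `A_χ(K̄)`, `A_χ(K̄_v)`, cohomology, local conditions -/

variable {K : Type u} [Field K] (W : WeierstrassCurve K) {p : ℕ} [Fact p.Prime]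
variable (χ : Field.absoluteGaloisGroup K →ₜ* Multiplicative (ZMod p))

/-- `A_χ(K̄)`: the twist of `E(K̄) = W.geomPoints` along `χ`, a discrete `Γ_K`-module (MR Def.
3.3, Thm. 3.4(iii) with `X = K̄`). [cite: MazurRubin2007, Def 3.3 and Thm 3.4(iii)] -/
abbrev geomModule : Type u :=
  ↥(points (χ : Field.absoluteGaloisGroup K →* Multiplicative (ZMod p)) W.geomPoints)

/-- `H¹(K, A_χ) = H¹_cont(Γ_K, A_χ(K̄))` (the tree's `discreteH1`). [cite: MazurRubin2007, §2] -/
abbrev galH1 : Type u := discreteH1 (Field.absoluteGaloisGroup K) (geomModule W χ)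

/-- `A_χ[p^∞] = A_χ[𝔓^∞]` (`𝔓^{p-1} = (p)` in `R_L`), with its `Γ_K`-action.
[cite: MazurRubin2007, §2] -/
abbrev primaryModule : AddSubgroup (geomModule W χ) :=
  AddCommGroup.primaryComponent (geomModule W χ) p

/-- `H¹(K, A_χ[p^∞])`. [cite: MazurRubin2007, §2] -/
abbrev galH1Primary : Type u := discreteH1 (Field.absoluteGaloisGroup K) ↥(primaryModule W χ)

variable (E : Type u) [Field E] [Algebra K E]

/-- The local character `χ ∘ (Γ_E → Γ_K)` at a `K`-field `E` (a completion `K_v`; `resGal`, file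
`Sha`), cutting out `(L ⊗_K K_v)/K_v`. [cite: MazurRubin2007, §5] -/
abbrev localChar : Field.absoluteGaloisGroup E →* Multiplicative (ZMod p) :=
  (χ : Field.absoluteGaloisGroup K →* Multiplicative (ZMod p)).comp (resGal (K := K) E)

/-- `A_χ(K̄_E)`: the twist of the local points `E(K̄_E)` along the local character, a discrete
`Γ_E`-module (MR §5: `A(\bar K_v) ⊂ E(\bar K_v ⊗ L)`). [cite: MazurRubin2007, §5] -/
abbrev localModule : Type u := ↥(points (localChar χ E) (localPoints W E))

/-- The localisation `A_χ(K̄) → A_χ(K̄_E)` induced by the chosen embedding `K̄ → K̄_E`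
(`pointsMap`, coordinatewise). [cite: MazurRubin2007, §5] -/
def locMap : geomModule W χ →+ localModule W χ E :=
  pushforward (χ : Field.absoluteGaloisGroup K →* Multiplicative (ZMod p)) W.geomPoints
    (resGal (K := K) E : Field.absoluteGaloisGroup E →* Field.absoluteGaloisGroup K)
    (pointsMap W E)

/-- Equivariance of the localisation along `Γ_E → Γ_K` (a compatible pair). [folklore] -/
theorem locMap_smul (τ : Field.absoluteGaloisGroup E) (f : geomModule W χ) :
    locMap W χ E (resGal (K := K) E τ • f) = τ • locMap W χ E f :=
  pushforward_smul _ _ _ _ (pointsMap_smul W E) τ f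

/-- The local kernel `ker (H¹(K, A_χ) → H¹(E, A_χ))` (the local condition defining `Ш(A_χ/K)`).
[cite: MazurRubin2007, §2] -/
def localKer : AddSubgroup (galH1 W χ) :=
  resKer (resGal (K := K) E) (locMap W χ E) (locMap_smul W χ E)

/-- **The `𝔓`-Selmer local condition** at `E`, inside `H¹(K, E[p])`: the kernel of
`H¹(K, E[p]) → H¹(E, A_χ)` along `E[p] = A_χ[𝔓] ⊆ A_χ(K̄) → A_χ(K̄_E)` (MR Def. 4.3: the Selmer
structure `𝒜` on `E[p]`, `H¹_𝒜(K_v, E[p]) =` image of `A(K_v)/𝔓A(K_v)` in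
`H¹(K_v, A[𝔓]) ≅ H¹(K_v, E[p])`, read on global classes as in `WeierstrassCurve.selmerLocalKer`).
[cite: MazurRubin2007, Def 4.3] -/
def selmerLocalKer : AddSubgroup (W.galH1Torsion p) :=
  resKer (resGal (K := K) E) ((locMap W χ E).comp (constEmb _ W.geomPoints)) fun τ P ↦ by
    rw [AddMonoidHom.comp_apply, AddMonoidHom.comp_apply, constEmb_smul, locMap_smul]

/-- The `p^∞` (= `𝔓^∞`) local kernel `ker (H¹(K, A_χ[p^∞]) → H¹(E, A_χ))`.
[cite: MazurRubin2007, §2] -/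
def selmerLocalKerPrimary : AddSubgroup (galH1Primary W χ) :=
  resKer (resGal (K := K) E) ((locMap W χ E).comp (primaryModule W χ).subtype) fun τ P ↦ by
    change locMap W χ E (((resGal (K := K) E τ • P : ↥(primaryModule W χ)) : geomModule W χ)) =
      τ • locMap W χ E (P : geomModule W χ)
    rw [primaryComponent.coe_smul, locMap_smul]

section NumberField

open NumberField IsDedekindDomain

variable [NumberField K]

/-- **`Sel_𝔓(A_χ/K) ⊆ H¹(K, E[p])`**, the `𝔓`-Selmer group of the twist over the number field
`K`: the classes satisfying the `𝔓`-Selmer local condition at every finite place `v`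
(`K_v = v.adicCompletion K`) and every infinite place `w` (`K_w = w.Completion`); it lives in
`H¹(K, E[p]) = W.galH1Torsion p` next to `Sel_p(E/K) = W.selmerGroup p` (MR Def. 4.3:
`H¹_𝒜(K, E[p]) = Sel_𝔓(A/K)`). [cite: MazurRubin2007, Def 4.3] -/
def selmerGroup : AddSubgroup (W.galH1Torsion p) :=
  (⨅ v : HeightOneSpectrum (𝓞 K), selmerLocalKer W χ (v.adicCompletion K)) ⊓
    ⨅ w : InfinitePlace K, selmerLocalKer W χ w.Completion

/-- Membership in `Sel_𝔓(A_χ/K)`. [cite: MazurRubin2007, Def 4.3] -/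
theorem mem_selmerGroup_iff (c : W.galH1Torsion p) :
    c ∈ selmerGroup W χ ↔
      (∀ v : HeightOneSpectrum (𝓞 K), c ∈ selmerLocalKer W χ (v.adicCompletion K)) ∧
        ∀ w : InfinitePlace K, c ∈ selmerLocalKer W χ w.Completion := by
  simp only [selmerGroup, AddSubgroup.mem_inf, AddSubgroup.mem_iInf]

/-- `Sel_{𝔓^∞}(A_χ/K) = Sel_{p^∞}(A_χ/K) ⊆ H¹(K, A_χ[p^∞])`. [cite: MazurRubin2007, §2] -/
def selmerGroupPInfty : AddSubgroup (galH1Primary W χ) :=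
  (⨅ v : HeightOneSpectrum (𝓞 K), selmerLocalKerPrimary W χ (v.adicCompletion K)) ⊓
    ⨅ w : InfinitePlace K, selmerLocalKerPrimary W χ w.Completion

/-- **`Ш(A_χ/K) = ker (H¹(K, A_χ) → ∏_v H¹(K_v, A_χ))`**. [cite: MazurRubin2007, §2] -/
def sha : AddSubgroup (galH1 W χ) :=
  (⨅ v : HeightOneSpectrum (𝓞 K), localKer W χ (v.adicCompletion K)) ⊓
    ⨅ w : InfinitePlace K, localKer W χ w.Completion

/-- Membership in `Ш(A_χ/K)`. [cite: MazurRubin2007, §2] -/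
theorem mem_sha_iff (c : galH1 W χ) :
    c ∈ sha W χ ↔ (∀ v : HeightOneSpectrum (𝓞 K), c ∈ localKer W χ (v.adicCompletion K)) ∧
      ∀ w : InfinitePlace K, c ∈ localKer W χ w.Completion := by
  simp only [sha, AddSubgroup.mem_inf, AddSubgroup.mem_iInf]

/-- **Comparison**: if the `𝔓`- and `p`-Selmer local conditions agree at every place then
`Sel_𝔓(A_χ/K) = Sel_p(E/K)` in `H¹(K, E[p])` (the formal part of MR Cor. 4.6 / Prop. 1.3; the
local comparisons are the arithmetic input). [cite: MazurRubin2007, Cor 4.6] -/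
theorem selmerGroup_eq_selmerGroup
    (hv : ∀ v : HeightOneSpectrum (𝓞 K),
      selmerLocalKer W χ (v.adicCompletion K) = W.selmerLocalKer (v.adicCompletion K) p)
    (hw : ∀ w : InfinitePlace K,
      selmerLocalKer W χ w.Completion = W.selmerLocalKer w.Completion p) :
    selmerGroup W χ = W.selmerGroup p := by
  simp only [selmerGroup, WeierstrassCurve.selmerGroup, hv, hw]

end NumberField

end PrimeTwist

/-! ## Unramified prime twists: `L` inside the Hilbert class field -/

open NumberField IsDedekindDomain GaloisRepresentations in
/-- **An unramified cyclic extension `L/K` of prime degree `p`**, presented by a continuous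
surjective character `χ : Γ_K → Gal(L/K) ≅ ZMod p` (`L = K̄^{ker χ}`) that is unramified at
every finite place `v` (trivial on the inertia group `I_𝔓 = 𝔓.inertia Γ_K` of every prime `𝔓`
of `\bar ℤ_K = absIntegers (𝓞 K) K` above `v`) and split at every infinite place (trivial on the
decomposition group `Γ_{K_w} → Γ_K`): `L` is a degree-`p` subfield of the Hilbert class field of
`K` (so `p ∣ h_K`). This is the datum `L ∈ Ξ`, `[L : K] = p`, of Mazur–Rubin's twists `A_L`
(Def. 3.2–3.3) in the everywhere-unramified case, where every `v ∤ p` of good reduction lies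
outside the set `S` of Cor. 4.6. [cite: MazurRubin2007, Def 3.2–3.3] -/
structure UnramifiedPrimeTwist (K : Type u) [Field K] [NumberField K] (p : ℕ) [Fact p.Prime] where
  /-- the character `Γ_K → Gal(L/K) ≅ ZMod p` cutting out `L` -/
  char : Field.absoluteGaloisGroup K →ₜ* Multiplicative (ZMod p)
  /-- `[L : K] = p` -/
  surjective : Function.Surjective char
  /-- `L/K` is unramified at every finite place: `χ` is trivial on every inertia group -/
  unramified : ∀ (v : HeightOneSpectrum (𝓞 K)) (𝔓 : Ideal (absIntegers (𝓞 K) K)),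
    𝔓 ∈ v.primesAbove → ∀ γ ∈ 𝔓.inertia (Field.absoluteGaloisGroup K), char γ = 1
  /-- `L/K` is split at every infinite place -/
  split : ∀ (w : InfinitePlace K) (τ : Field.absoluteGaloisGroup w.Completion),
    char (resGal (K := K) w.Completion τ) = 1

namespace UnramifiedPrimeTwist

variable {K : Type u} [Field K] [NumberField K] {p : ℕ} [Fact p.Prime]
variable (T : UnramifiedPrimeTwist K p) (W : WeierstrassCurve K)

/-- `A_L(K̄)` for the unramified twist `L = K̄^{ker T.char}` of `W`.
[cite: MazurRubin2007, Def 3.3] -/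
abbrev geomModule : Type u := PrimeTwist.geomModule W T.char

/-- `Sel_𝔓(A_L/K) ⊆ H¹(K, E[p])`. [cite: MazurRubin2007, Def 4.3] -/
abbrev selmerGroup : AddSubgroup (W.galH1Torsion p) := PrimeTwist.selmerGroup W T.char

/-- `Sel_{𝔓^∞}(A_L/K)`. [cite: MazurRubin2007, §2] -/
abbrev selmerGroupPInfty : AddSubgroup (PrimeTwist.galH1Primary W T.char) :=
  PrimeTwist.selmerGroupPInfty W T.char

/-- `Ш(A_L/K)`. [cite: MazurRubin2007, §2] -/
abbrev sha : AddSubgroup (PrimeTwist.galH1 W T.char) := PrimeTwist.sha W T.char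

/-- `Ш(A_L/K)[𝔓^∞] = Ш(A_L/K)[p^∞]`. [cite: MazurRubin2007, §6 and App. A] -/
abbrev shaPrimary : AddSubgroup ↥(T.sha W) := AddCommGroup.primaryComponent ↥(T.sha W) p

end UnramifiedPrimeTwist

end Literature.NumberTheory.EllipticCurves
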